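import Literature.RingTheory.Derivation.RegularFoliationQuotient
import Literature.RingTheory.Derivation.SliceDecomposition
import Literature.RingTheory.Derivation.HochschildFormula
import Literature.AlgebraicGeometry.Resolution.RegularLocalRingsFlatDescent
import HarnessLib

/-!
# The quotient by a regular rank-one `1`-foliation is regular — PROOF of the named fact `Posva2023_Lemma_2_37_rank1`

Topic: `Literature/RingTheory/Derivation`; sibling proof file of `RegularFoliationQuotient.lean` (the fact
`Posva2023_Lemma_2_37_rank1`: Q. Posva, *On the singularities of quotients by 1-foliations*, Nagoya Math. J.
**261** (2026) e6, Lemma 2.37 direction ⇐, rank one, read at a point: for `A` a regular local ring essentially of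
finite type over a perfect field `k` of characteristic `p` and `D ∈ Der_k(A)` which is `p`-closed and has a unit
value, the ring of constants `A^D` is a regular local ring). Here the fact is DISCHARGED:
`Posva2023_Lemma_2_37_rank1_holds`.

Proof (the classical slice argument — Matsumura, *Commutative Ring Theory*, Thm. 25.5 / §25 Ex. 25.5 / Thm. 23.7;
the source's own proof goes through the Seshadri–Yuan normal form, Lemma 2.18, which is not needed here):
* §1 `iterate_inv_smul_eq_zero`: with `u = D f` a unit, the rescaled derivation `δ = u⁻¹ D` has `δ f = 1` and is
  NILPOTENT, `δ^[p] = 0` — Hochschild's formula (tree `Derivation.hochschild_iterate_smul`) gives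
  `δ^[p] = c · D` for one `c ∈ A`, and evaluating at `f` (`δ^[p] f = δ^[p-1] 1 = 0`, `D f` a unit) forces `c = 0`.
  The constants of `δ` are the constants of `D`.
* §2 Slice structure (any commutative ring `A` of characteristic `p`, `δ f = 1`, `δ^[p] = 0`, `B = ker δ`):
  `A = ⊕_{i<p} B fⁱ` (tree `SliceDecomposition.existsUnique_fin_sum_mul_pow`, Matsumura Ex. 25.5), so
  `(fⁱ)_{i<p}` is a `B`-basis of `A` (`linearIndependent_pow`, `top_le_span_pow`): `A` is free, hence faithfully
  flat, over `B`; units of `A` lying in `B` are units of `B` (`isUnit_of_isUnit_coe`), so `B` is local when `A`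
  is and `B → A` is a local homomorphism; `B` is Noetherian when `A` is (ideals of `B` extend INJECTIVELY to `A`
  by faithful flatness, Mathlib `Ideal.map_injective_of_faithfullyFlat`, so the ascending chain condition
  descends along the strictly monotone `Ideal.map`).
* §3 Flat descent of regularity (Matsumura Thm. 23.7 (i), tree `IsRegularLocalRing.of_flat_of_isLocalHom`):
  `isRegularLocalRing_of_slice`, and the fact `Posva2023_Lemma_2_37_rank1_holds`.

The hypotheses «`k` perfect» and «`A` essentially of finite type over `k`» of the typed fact are not used by this
route (the print needs them for `F`-finiteness, Lemma 2.35 (2), and for the normal form, Lemma 2.18). No new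
definitions; no named facts are used.
-/

noncomputable section

open IsLocalRing

namespace Literature.RingTheory.Derivation

universe u v

namespace Posva2023_Lemma_2_37_rank1

/-! ## §1 Nilpotent normalisation of a `p`-closed derivation with a unit value (rings) -/

section Normalisation

variable {R : Type u} {A : Type v} [CommRing R] [CommRing A] [Algebra R A]

/-- **Nilpotent normalisation** (ring form of the Rudakov–Shafarevich remark; Matsumura Thm. 25.5): if `D` is
`p`-closed (`D^[p] = a·D`) on a commutative ring of prime characteristic `p` and `D f = u` is a unit, then the
rescaled derivation `δ = u⁻¹ • D` satisfies `δ^[p] = 0` (Hochschild: `δ^[p] = c · D`; `δ^[p] f = δ^[p-1] 1 = 0`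
and `D f` a unit give `c = 0`). [cite: Matsumura1987, Thm. 25.5 (Hochschild's formula) and §25 Ex. 25.5] -/
theorem iterate_inv_smul_eq_zero {p : ℕ} (hp : p.Prime) [CharP A p] (D : _root_.Derivation R A A) {a : A}
    (hDp : ∀ b : A, (⇑D)^[p] b = a * D b) {f : A} (u : Aˣ) (hu : D f = u) (b : A) :
    (⇑((↑u⁻¹ : A) • D))^[p] b = 0 := by
  set δ : _root_.Derivation R A A := (↑u⁻¹ : A) • D with hδ
  have hδf : δ f = 1 := by
    rw [hδ, _root_.Derivation.smul_apply, smul_eq_mul, hu, Units.inv_mul]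
  -- Hochschild: `δ^[p] x = c * D x` for one `c`
  have hH : ∀ x : A, (⇑δ)^[p] x = ((↑u⁻¹ : A) ^ p * a + (⇑δ)^[p - 1] (↑u⁻¹ : A)) * D x := fun x => by
    rw [hδ, _root_.Derivation.hochschild_iterate_smul hp D (↑u⁻¹ : A) x, hDp x]
    ring
  -- evaluate at `f`: `δ^[p] f = δ^[p-1] (δ f) = δ^[p-1] 1 = 0`
  have h1 : (⇑δ)^[p - 1] (1 : A) = 0 := by
    obtain ⟨m, hm⟩ : ∃ m, p - 1 = m + 1 := ⟨p - 2, by have := hp.two_le; omega⟩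
    rw [hm, Function.iterate_succ_apply, _root_.Derivation.map_one_eq_zero]
    exact Function.iterate_fixed (map_zero δ) m
  have hf0 : (⇑δ)^[p] f = 0 := by
    have hp1 : p = (p - 1) + 1 := (Nat.succ_pred_eq_of_pos hp.pos).symm
    conv_lhs => rw [hp1]
    rw [Function.iterate_succ_apply, hδf, h1]
  have hc : (↑u⁻¹ : A) ^ p * a + (⇑δ)^[p - 1] (↑u⁻¹ : A) = 0 := by
    have h := hH f
    rw [hf0, hu] at h
    exact ((Units.mul_left_eq_zero u).mp h.symm)
  rw [hH b, hc, zero_mul]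

end Normalisation

/-! ## §2 The slice structure: `A = ⊕_{i<p} B fⁱ` over the ring of constants `B` -/

section Slice

variable {R : Type u} {A : Type v} [CommRing R] [CommRing A] [Algebra R A] (δ : _root_.Derivation R A A)
  (p : ℕ) [Fact p.Prime] [CharP A p] {f : A} (hf : δ f = 1) (hδp : ∀ a : A, (⇑δ)^[p] a = 0)
  (B : Subring A) (hB : ∀ c : A, c ∈ B ↔ δ c = 0)

include hf hδp hB

/-- **The powers `1, f, …, f^{p-1}` are linearly independent over the constants** (uniqueness in Matsumura's
Ex. 25.5). [cite: Matsumura1987, §25 Ex. 25.5] -/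
theorem linearIndependent_pow : LinearIndependent B (fun i : Fin p => f ^ (i : ℕ)) := by
  rw [Fintype.linearIndependent_iff]
  intro g hg i
  have hg' : (0 : A) = ∑ i, (g i : A) * f ^ (i : ℕ) := by
    rw [← hg]
    rfl
  have h1 : (∀ i, δ ((g i : A)) = 0) ∧ (0 : A) = ∑ i, (g i : A) * f ^ (i : ℕ) :=
    ⟨fun i => (hB _).mp (g i).2, hg'⟩
  have h2 : (∀ i : Fin p, δ ((fun _ : Fin p => (0 : A)) i) = 0) ∧
      (0 : A) = ∑ i : Fin p, (fun _ : Fin p => (0 : A)) i * f ^ (i : ℕ) :=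
    ⟨fun _ => map_zero δ, by simp⟩
  have h := (existsUnique_fin_sum_mul_pow δ p hf hδp (0 : A)).unique h1 h2
  have hi : (g i : A) = 0 := congrFun h i
  exact_mod_cast hi

/-- **The powers `1, f, …, f^{p-1}` span `A` over the constants** (existence in Matsumura's Ex. 25.5).
[cite: Matsumura1987, §25 Ex. 25.5] -/
theorem top_le_span_pow : ⊤ ≤ Submodule.span B (Set.range fun i : Fin p => f ^ (i : ℕ)) := by
  intro a _
  obtain ⟨c, ⟨hc, hca⟩, -⟩ := existsUnique_fin_sum_mul_pow δ p hf hδp a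
  rw [hca]
  refine Submodule.sum_mem _ fun i _ => ?_
  have h : c i * f ^ (i : ℕ) = (⟨c i, (hB _).mpr (hc i)⟩ : B) • f ^ (i : ℕ) := rfl
  rw [h]
  exact Submodule.smul_mem _ _ (Submodule.subset_span ⟨i, rfl⟩)

/-- **`A` is a free `B`-module** (basis `1, f, …, f^{p-1}`), hence flat and — `A` being non-trivial — faithfully
flat over the ring of constants. [cite: Matsumura1987, §25 Ex. 25.5] -/
theorem free : Module.Free B A :=
  Module.Free.of_basis (Module.Basis.mk (linearIndependent_pow δ p hf hδp B hB) (top_le_span_pow δ p hf hδp B hB))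

omit hf hδp in
/-- A constant which is a unit of `A` is a unit of the ring of constants (the inverse of a constant is a
constant: `δ(v⁻¹) = -v⁻² δ v`). [cite: Matsumura1987, §25 (derivations; Leibniz rule for inverses)] -/
theorem isUnit_of_isUnit_coe {b : B} (h : IsUnit (b : A)) : IsUnit b := by
  have hinv : δ (↑h.unit⁻¹ : A) = 0 := by
    rw [δ.leibniz_of_mul_eq_one (Units.inv_mul h.unit), h.unit_spec, (hB _).mp b.2, smul_zero]
  refine isUnit_iff_exists_inv.mpr ⟨⟨(↑h.unit⁻¹ : A), (hB _).mpr hinv⟩, Subtype.ext ?_⟩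
  change (b : A) * ↑h.unit⁻¹ = 1
  exact h.mul_val_inv

omit hf hδp in
/-- The ring of constants of a local ring is local. [cite: Matsumura1987, §25 (derivations)] -/
theorem isLocalRing [IsLocalRing A] : IsLocalRing B :=
  IsLocalRing.of_isUnit_or_isUnit_one_sub_self fun b =>
    (IsLocalRing.isUnit_or_isUnit_one_sub_self (b : A)).imp (isUnit_of_isUnit_coe δ B hB)
      (isUnit_of_isUnit_coe δ B hB)

omit hf hδp in
/-- The inclusion of the ring of constants is a local homomorphism. [cite: Matsumura1987, §25 (derivations)] -/
theorem isLocalHom : IsLocalHom (algebraMap B A) :=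
  ⟨fun _ h => isUnit_of_isUnit_coe δ B hB h⟩

/-- **The ring of constants is Noetherian** when `A` is: `A` is faithfully flat over `B` (free, `A ≠ 0`), so
`Ideal.map : Ideal B → Ideal A` is injective and monotone, hence strictly monotone, and the ascending chain
condition descends. [cite: Matsumura1987, Thm. 7.5 (faithful flatness) with §25 Ex. 25.5] -/
theorem isNoetherianRing [Nontrivial A] [IsNoetherianRing A] : IsNoetherianRing B := by
  haveI : Module.Free B A := free δ p hf hδp B hB
  haveI : Module.FaithfullyFlat B A := inferInstance
  have hmono : StrictMono (Ideal.map (algebraMap B A)) :=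
    Monotone.strictMono_of_injective (f := Ideal.map (algebraMap B A)) (fun _ _ h => Ideal.map_mono h)
      Ideal.map_injective_of_faithfullyFlat
  haveI : WellFoundedGT (Ideal A) := isNoetherian_iff'.mp ‹IsNoetherianRing A›
  exact isNoetherian_iff'.mpr hmono.wellFoundedGT

/-- **The ring of constants of a regular local ring along a slice is regular** (Matsumura Thm. 23.7 (i): `B → A` is
a flat local homomorphism of Noetherian local rings with `A` regular, so `B` is regular — tree
`IsRegularLocalRing.of_flat_of_isLocalHom`). [cite: Matsumura1987, Thm. 23.7 (i) with §25 Ex. 25.5] -/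
theorem isRegularLocalRing_of_slice [IsRegularLocalRing A] : IsRegularLocalRing B := by
  haveI : IsLocalRing B := isLocalRing δ B hB
  haveI : IsNoetherianRing B := isNoetherianRing δ p hf hδp B hB
  haveI : Module.Free B A := free δ p hf hδp B hB
  haveI : IsLocalHom (algebraMap B A) := isLocalHom δ B hB
  exact Literature.AlgebraicGeometry.Resolution.IsRegularLocalRing.of_flat_of_isLocalHom B A

end Slice

end Posva2023_Lemma_2_37_rank1

/-! ## §3 Assembly: the fact holds -/

open Posva2023_Lemma_2_37_rank1 in
/-- **Posva, Nagoya Math. J. 261 (2026) e6, Lemma 2.37 ⇐ (rank one, at a point) — PROVED**: for a regular local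
ring `A` (essentially of finite type over a perfect field `k` of characteristic `p`) and a `p`-closed `k`-derivation
`D` of `A` with a unit value, every subring `B = {c | D c = 0}` of `A` is a regular local ring. Discharges the
named fact `Posva2023_Lemma_2_37_rank1` of `RegularFoliationQuotient.lean` (route: nilpotent normalisation §1,
slice decomposition §2, flat descent of regularity). [cite: Posva2023, Lemma 2.37 p. 16 (⇐)] -/
theorem Posva2023_Lemma_2_37_rank1_holds : Posva2023_Lemma_2_37_rank1.{u, v} := by
  intro p _ k _ _ _ A _ _ _ _ D hDp hfu B hB
  obtain ⟨a, ha⟩ := hDp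
  obtain ⟨f, hf⟩ := hfu
  haveI : CharP A p := charP_of_injective_algebraMap (algebraMap k A).injective p
  have hu : D f = ↑hf.unit := hf.unit_spec.symm
  have hδf : ((↑hf.unit⁻¹ : A) • D) f = 1 := by
    rw [_root_.Derivation.smul_apply, smul_eq_mul]
    exact hf.val_inv_mul
  have hδp : ∀ b : A, (⇑((↑hf.unit⁻¹ : A) • D))^[p] b = 0 :=
    iterate_inv_smul_eq_zero (Fact.out) D ha hf.unit hu
  have hBδ : ∀ c : A, c ∈ B ↔ ((↑hf.unit⁻¹ : A) • D) c = 0 := fun c => by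
    rw [hB c, _root_.Derivation.smul_apply, smul_eq_mul, Units.mul_right_eq_zero]
  exact isRegularLocalRing_of_slice ((↑hf.unit⁻¹ : A) • D) p hδf hδp B hBδ

end Literature.RingTheory.Derivation

end
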